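import Literature.MathematicalPhysics.QuantumFieldTheory.Balaban1983to89.B9Thm311AdjointPairs

/-!
# `Balaban1983to89.B9Thm311DeltaPrimeAsymm` — located finding R7 AS A KERNEL STATEMENT: def-Y's v2∕v3 letter `deltaPrimeAY i (parSY i) U` (taxicab site
# transporters) is NOT symmetric for the trace pairing at ANY unitary-valued `U` whose in-block rectangle holonomy `U(Γ_{z,c})·U(Γ_{c,z})` at one site
# `z` (block corner `c`) acts non-trivially by conjugation (referee ref-A g15 WATCH-S, ASK (ii))

T. Bałaban, *Propagators for lattice gauge theories in a background field*, Commun. Math. Phys. **99** (1985) 389–434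
[`Balaban1985BackgroundPropagators`, "B9"]; [4] = *Propagators … II* [`Balaban1984PropagatorsII`].

statement-level skeleton of published theorems with citation tags; proofs where landed; nothing here is a claim about the
Yang–Mills mass gap

THE PRINTED LOCUS (verbatim, p. 394, (3.24)): *"Let us introduce the operator Δ′_a = Δ′_a(U) = (Δ^η_U + Q′\*aQ′)|_{Ω₀} where Q′\*aQ′ is defined by the same
quadratic form as in (2.14), i.e. ⟨λ, Q′\*aQ′λ⟩ = Σ_j a_j Σ_{y∈Λ_j} (L^jη)^{d−2}|(Q′_j(U)λ)(y)|²"* — a quadratic form, hence a SYMMETRIC operator.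

WHY THIS FILE.  `B9Thm311DeltaPrimeSymm` REPAIRED the letter (`avgTrY'`, route (S) `parSymY`, v4 record) and proved the repaired Δ′_a(U) symmetric; this file
states the NEGATIVE for the unrepaired letter as a theorem with ONE configuration-dependent hypothesis: testing the pairing on `δ_c ⊗ E` and `δ_z ⊗ E′`
(`c` the corner of the block of `z`) the covariant-Laplacian contributions cancel (`lapSL_isSymmTr`) and the averaging term leaves
`levC·[Re tr((R(τ_{zc})E)\*E′) − Re tr(E\*R(τ_{cz})E′)]` with `τ_{zc} = U(Γ_{z,c})`, `τ_{cz} = U(Γ_{c,z})` (`parSY_self`); at unitary transporters this is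
`levC·Re tr(E\*[R(U(Γ_{z,c})⁻¹) − R(U(Γ_{c,z}))]E′)`, non-zero for suitable `E, E′` exactly when the two conjugations differ, i.e. when the rectangle holonomy
`U(Γ_{z,c})U(Γ_{c,z})` is not central.  The remaining hypothesis — a (3.35)-regular configuration with one non-central in-block rectangle holonomy —
is a configuration WITNESS left to a disprover seat (numerically: random SU(2), L = 3: pairing defect 3.86, `HOME/numerics`).

* §1 `kernelTrOpY_deltaY`, `trIP_one_kernelTrOpY_deltaY_deltaY`, ★ `deltaPrimeAY_pairing_defect` (the symmetry defect on two deltas, any table).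
* §2 ★★ `not_isSymmTr_deltaPrimeAY_of_conj_ne` (generic table: defect ≠ 0 ⇒ not symmetric), `avgCoeffY_corner_ne_zero` (the corner of the block of `z` IS
  coupled to `z`), ★★★ `not_isSymmTr_deltaPrimeAY_parSY` (taxicab table: non-trivial rectangle-holonomy conjugation at one site ⇒ NOT symmetric).

HONEST SCOPE.  A conditional negative (the configuration witness is hypothesis `hhol`); finite-dimensional algebra; nothing of [B9] asserted — on the contrary
it certifies that the v2∕v3 letter deviates from (3.24); count-neutral; nothing continuum, nothing about the mass gap.  Cell `pub-ymgap` (HUMAN RULING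
D-0062), Track A node N06 [B9], seat `pub-ymgap-dag-n06-j` (harness re-seat gen 6), 2026-08-27.
-/

namespace Literature.MathematicalPhysics.QuantumFieldTheory.Balaban1983to89.B9Thm311DeltaPrimeAsymm

open Literature.MathematicalPhysics.QuantumFieldTheory.Balaban1983to89
open B9Thm311ReadingCoords B9Thm311AdjointAtLetters B9Thm311DeltaPrimeSymm B9Thm311AdjointPairs B9Ineq349SiteAdjoint Node00
open B6KLevelCensusIndexV1 B6Geom246MultiLevelBox B6MultiLevelBoxOperator B9PinMembersKLevelV1 B7Prop2SpecialUnitary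
open scoped Matrix

noncomputable section

/-! ## §1 The symmetry defect of `Δ′_a(U)` on two deltas -/

section Defect

open scoped Matrix.Norms.L2Operator

variable {d ℓ : ℕ} {hd : 1 ≤ d + 1} {hL : Odd (ℓ + 1) ∧ 1 < ℓ + 1} {b₀ b₁ : ℝ} {N : ℕ}
variable (i : KIdx d ℓ hd hL b₀ b₁)

/-- a transported kernel operator on a delta: `(K♯_T (δ_s ⊗ E))(z) = K(z, s) • R(T(z, s))E`. [cite: Balaban1985BackgroundPropagators, (3.19) p.393, bookkeeping] -/
theorem kernelTrOpY_deltaY {X : Type} [Fintype X] [DecidableEq X] (K : X → X → ℝ) (T : X → X → (Matrix (Fin N) (Fin N) ℂ)ˣ) (s : X)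
    (E : Matrix (Fin N) (Fin N) ℂ) (z : X) : kernelTrOpY K T (deltaY s E) z = ((K z s : ℝ) : ℂ) • B9Eq39Adjoint.R (T z s) E := by
  rw [kernelTrOpY_apply, Finset.sum_eq_single s]
  · simp [deltaY]
  · intro w _ hw
    simp [deltaY, hw, B9Eq39Adjoint.R_zero]
  · intro h; exact absurd (Finset.mem_univ s) h

/-- the pairing of a transported kernel operator between two deltas: `⟨K♯_T(δ_c⊗E), δ_z⊗E′⟩₁ = K(z, c)·Re tr((R(T(z,c))E)\*E′)`.
[cite: Balaban1985BackgroundPropagators, (3.19) p.393, p.393 (scalar products), bookkeeping] -/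
theorem trIP_one_kernelTrOpY_deltaY_deltaY {X : Type} [Fintype X] [DecidableEq X] (K : X → X → ℝ) (T : X → X → (Matrix (Fin N) (Fin N) ℂ)ˣ)
    (c z : X) (E E' : Matrix (Fin N) (Fin N) ℂ) :
    trIP (fun _ => (1 : ℝ)) (kernelTrOpY K T (deltaY c E)) (deltaY z E') = K z c * (Matrix.trace ((B9Eq39Adjoint.R (T z c) E)ᴴ * E')).re := by
  rw [trIP_deltaY_right, one_mul, kernelTrOpY_deltaY, Matrix.conjTranspose_smul, Matrix.smul_mul, Matrix.trace_smul, Complex.star_def, Complex.conj_ofReal,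
    smul_eq_mul, Complex.re_ofReal_mul]

/-- ★ **THE SYMMETRY DEFECT OF `Δ′_a(U)` ON TWO DELTAS** (any transporter table with unitary values for the Laplacian's configuration): the covariant-Laplacian
parts cancel (`lapSL_isSymmTr`) and `⟨Δ′_a(δ_c⊗E), δ_z⊗E′⟩ − ⟨δ_c⊗E, Δ′_a(δ_z⊗E′)⟩ = a(z,c)·Re tr((R(τ_{zc})E)\*E′) − a(c,z)·Re tr(E\*·R(τ_{cz})E′)`.
[cite: Balaban1985BackgroundPropagators, (3.24) p.394, (3.8) p.392] -/
theorem deltaPrimeAY_pairing_defect (par : SiteParY (Matrix (Fin N) (Fin N) ℂ) i) (U : CfgY (Matrix (Fin N) (Fin N) ℂ) i)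
    (hU : ∀ μ x, ((U μ x : (Matrix (Fin N) (Fin N) ℂ)ˣ) : Matrix (Fin N) (Fin N) ℂ) ∈ unitary (Matrix (Fin N) (Fin N) ℂ))
    (c z : SiteY i) (E E' : Matrix (Fin N) (Fin N) ℂ) :
    trIP (fun _ => (1 : ℝ)) (deltaPrimeAY i par U (deltaY c E)) (deltaY z E') - trIP (fun _ => (1 : ℝ)) (deltaY c E) (deltaPrimeAY i par U (deltaY z E')) =
      avgCoeffY i z c * (Matrix.trace ((B9Eq39Adjoint.R (avgTrY i par U z c) E)ᴴ * E')).re -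
        avgCoeffY i c z * (Matrix.trace (Eᴴ * B9Eq39Adjoint.R (avgTrY i par U c z) E')).re := by
  have hlap := lapSL_isSymmTr i U hU (deltaY c E) (deltaY z E')
  have h1 : trIP (fun _ => (1 : ℝ)) (deltaPrimeAY i par U (deltaY c E)) (deltaY z E') =
      trIP (fun _ => (1 : ℝ)) (lapSL i U (deltaY c E)) (deltaY z E') + avgCoeffY i z c * (Matrix.trace ((B9Eq39Adjoint.R (avgTrY i par U z c) E)ᴴ * E')).re := by
    rw [deltaPrimeAY, LinearMap.add_apply, ← trIP_one_kernelTrOpY_deltaY_deltaY]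
    simp only [trIP, Pi.add_apply, Matrix.add_apply, star_add, add_mul, Complex.add_re, Finset.sum_add_distrib, mul_add]
  have h2 : trIP (fun _ => (1 : ℝ)) (deltaY c E) (deltaPrimeAY i par U (deltaY z E')) =
      trIP (fun _ => (1 : ℝ)) (deltaY c E) (lapSL i U (deltaY z E')) + avgCoeffY i c z * (Matrix.trace (Eᴴ * B9Eq39Adjoint.R (avgTrY i par U c z) E')).re := by
    rw [deltaPrimeAY, LinearMap.add_apply]
    have hk : trIP (fun _ => (1 : ℝ)) (deltaY c E) (kernelTrOpY (avgCoeffY i) (avgTrY i par U) (deltaY z E')) =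
        avgCoeffY i c z * (Matrix.trace (Eᴴ * B9Eq39Adjoint.R (avgTrY i par U c z) E')).re := by
      rw [trIP_deltaY_left, one_mul, kernelTrOpY_deltaY, Matrix.mul_smul, Matrix.trace_smul, smul_eq_mul, Complex.re_ofReal_mul]
    rw [← hk]
    simp only [trIP, Pi.add_apply, Matrix.add_apply, mul_add, Complex.add_re, Finset.sum_add_distrib]
  rw [h1, h2, hlap]
  ring

end Defect

/-! ## §2 The negative: non-trivial rectangle-holonomy conjugation ⇒ the taxicab letter is not symmetric -/

section Negative

open scoped Matrix.Norms.L2Operator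

variable {d ℓ : ℕ} {hd : 1 ≤ d + 1} {hL : Odd (ℓ + 1) ∧ 1 < ℓ + 1} {b₀ b₁ : ℝ} {N : ℕ}
variable (i : KIdx d ℓ hd hL b₀ b₁)

/-- ★★ generic table: if at unitary transporters the two conjugations `R(τ_{zc}⁻¹)` and `R(τ_{cz})` DIFFER on some matrix, with `a(z,c) ≠ 0` and a symmetric coefficient,
then `Δ′_a(U)` is not symmetric (test on `δ_c ⊗ D`, `δ_z ⊗ E′` with `D` the difference: the defect is `a(z,c)·Re tr(D\*D) > 0`).
[cite: Balaban1985BackgroundPropagators, (3.24) p.394 (a quadratic form — symmetric), located defect] -/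
theorem not_isSymmTr_deltaPrimeAY_of_conj_ne (par : SiteParY (Matrix (Fin N) (Fin N) ℂ) i) (U : CfgY (Matrix (Fin N) (Fin N) ℂ) i)
    (hU : ∀ μ x, ((U μ x : (Matrix (Fin N) (Fin N) ℂ)ˣ) : Matrix (Fin N) (Fin N) ℂ) ∈ unitary (Matrix (Fin N) (Fin N) ℂ))
    (c z : SiteY i) (hzc : ((avgTrY i par U z c : (Matrix (Fin N) (Fin N) ℂ)ˣ) : Matrix (Fin N) (Fin N) ℂ) ∈ unitary (Matrix (Fin N) (Fin N) ℂ))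
    (hcoef : avgCoeffY i c z = avgCoeffY i z c) (hne : avgCoeffY i z c ≠ 0) (E' : Matrix (Fin N) (Fin N) ℂ)
    (hhol : B9Eq39Adjoint.R (avgTrY i par U z c)⁻¹ E' ≠ B9Eq39Adjoint.R (avgTrY i par U c z) E') :
    ¬ IsSymmTr (fun _ => (1 : ℝ)) (deltaPrimeAY i par U) := by
  intro hsymm
  set D := B9Eq39Adjoint.R (avgTrY i par U z c)⁻¹ E' - B9Eq39Adjoint.R (avgTrY i par U c z) E' with hD
  have hD0 : D ≠ 0 := sub_ne_zero.2 hhol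
  have hdef := deltaPrimeAY_pairing_defect i par U hU c z D E'
  rw [hsymm (deltaY c D) (deltaY z E'), sub_self, hcoef, trace_conjTranspose_R_mul _ hzc, ← mul_sub, ← Complex.sub_re, ← Matrix.trace_sub,
    ← Matrix.mul_sub] at hdef
  -- `hdef : 0 = a(z,c) · Re tr(D\* D)`, but `Re tr(D\*D) > 0`
  have hpos : 0 < (Matrix.trace (Dᴴ * D)).re := by
    have h := (B9Thm311ReadingCoords.posDef_conj311_realify311_iff (w := fun _ : Unit => (1 : ℝ)) (hw := fun _ => one_pos)
      (LinearMap.id : (Unit → Matrix (Fin N) (Fin N) ℂ) →ₗ[ℂ] (Unit → Matrix (Fin N) (Fin N) ℂ))).mp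
      (fun v hv => by simpa using real_inner_self_pos.2 hv) (fun _ => D) (fun h0 => hD0 (congrFun h0 ()))
    rw [trIP_eq_re_trace] at h
    simpa using h
  exact (mul_ne_zero hne hpos.ne') hdef.symm

/-- the corner of the block of `z` IS coupled to `z` by the averaging coefficient (`levC_{lev z} > 0` on the block of `z`).
[cite: Balaban1984PropagatorsII, (2.14) p.225 (a_j > 0), bookkeeping] -/
theorem avgCoeffY_corner_ne_zero (z : SiteY i) : avgCoeffY i z (cornerY i (levY i z) z) ≠ 0 := by
  rw [avgCoeffY_eq_ite, cornerY_levY_eq]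
  have hb : blkOf i.D.toDomains (blkCornerY i (blkOf i.D.toDomains z)) = blkOf i.D.toDomains z := blkOf_corner i.D.toDomains _
  rw [if_pos hb]
  have hlev : 1 ≤ levY i z := (toKT i).D.one_le_lev z.1
  exact (levC_pos d ℓ (B6Prop23KLevelTorusCensus.aPrinted_pos (B9Cor35AtOneInverseLetters.one_le_ell i) _ hlev)).ne'

/-- ★★★ **LOCATED FINDING R7 AS A THEOREM**: with def-Y's TAXICAB site transporters `parSY`, at ANY unitary-valued configuration `U` for which the conjugations by
`U(Γ_{z,c})⁻¹` and by `U(Γ_{c,z})` (c the corner of the block of some site z) differ on some matrix — i.e. the in-block rectangle holonomy `U(Γ_{z,c})U(Γ_{c,z})`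
acts non-trivially — the v2∕v3 letter `deltaPrimeAY i (parSY i) U` is NOT symmetric for the trace pairing, contrary to (3.24).  (A (3.35)-regular non-flat `U`
with such a holonomy is the configuration witness left to a disprover; the v4 record over `parSymY` is symmetric, `B9Thm311DeltaPrimeSymm`.)
[cite: Balaban1985BackgroundPropagators, (3.24) p.394, (3.19) p.393, (3.40) p.397 (Γ_{z,z′})] -/
theorem not_isSymmTr_deltaPrimeAY_parSY (U : CfgY (Matrix (Fin N) (Fin N) ℂ) i)
    (hU : ∀ μ x, ((U μ x : (Matrix (Fin N) (Fin N) ℂ)ˣ) : Matrix (Fin N) (Fin N) ℂ) ∈ unitary (Matrix (Fin N) (Fin N) ℂ)) (z : SiteY i)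
    (E' : Matrix (Fin N) (Fin N) ℂ)
    (hhol : B9Eq39Adjoint.R (parSY i U z (cornerY i (levY i z) z))⁻¹ E' ≠ B9Eq39Adjoint.R (parSY i U (cornerY i (levY i z) z) z) E') :
    ¬ IsSymmTr (fun _ => (1 : ℝ)) (deltaPrimeAY i (parSY i) U) := by
  have hU' : ∀ μ x, U μ x ∈ B7Prop2Explicit.unitaryUnits (Matrix (Fin N) (Fin N) ℂ) := hU
  -- the corner `c` of the block of `z`: it lies in the same block and is its own reference corner
  have hc' : cornerY i (levY i z) z = blkCornerY i (blkOf i.D.toDomains z) := cornerY_levY_eq i z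
  have hblk : blkOf i.D.toDomains (cornerY i (levY i z) z) = blkOf i.D.toDomains z := by rw [hc']; exact blkOf_corner i.D.toDomains _
  have hcc : cornerY i (levY i (cornerY i (levY i z) z)) (cornerY i (levY i z) z) = cornerY i (levY i z) z := by
    rw [cornerY_levY_eq, hblk, ← hc']
  -- the two averaging transporters through the corner reduce to single contour variables
  have hzc : avgTrY i (parSY i) U z (cornerY i (levY i z) z) = parSY i U z (cornerY i (levY i z) z) := by
    rw [avgTrY, parSY_self, mul_one]
  have hcz : avgTrY i (parSY i) U (cornerY i (levY i z) z) z = parSY i U (cornerY i (levY i z) z) z := by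
    rw [avgTrY, hcc, parSY_self, one_mul]
  refine not_isSymmTr_deltaPrimeAY_of_conj_ne i (parSY i) U hU (cornerY i (levY i z) z) z ?_ (avgCoeffY_symm i _ _)
    (avgCoeffY_corner_ne_zero i z) E' ?_
  · rw [hzc]; exact hU' |> fun h => (parSY_mem i h z _ : parSY i U z _ ∈ B7Prop2Explicit.unitaryUnits _)
  · rw [hzc, hcz]; exact hhol

end Negative

end

end Literature.MathematicalPhysics.QuantumFieldTheory.Balaban1983to89.B9Thm311DeltaPrimeAsymm
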